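import Summits.CriticalPhenomena.PercolationContinuityZ3.Theorems.PercNearOneGluingNoHeavyLowerTailSahiE3Dnf
import Summits.CriticalPhenomena.PercolationContinuityZ3.Theorems.PercNearOneGluingNoHeavyLowerTailSahiE3LroSlot
import Mathlib.Tactic.Linarith
import Mathlib.Tactic.Ring
import Mathlib.Tactic.Positivity
import HarnessLib
import HarnessLib.Audit

/-!
# `NoHeavyLowerTail` (crux stmt-CriticalPhenomena-4575), Sahi programme P4: Sahi's `C₃` / Kahn's Conjecture 5 for a read-once DNF
# OR a linear read-once tail, `⋁ᵢ ⋀_{x ∈ Cᵢ} x ∨ F(z)`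

Support file (cell `prim-l12`, seat P4, generation 15; `--supports stmt-CriticalPhenomena-4575`).  No named facts, no sorries;
standard axioms; def-free.

`…SahiE3BlocksOver.cert_blocks_over` over the certified base of a LINEAR READ-ONCE formula `F(z₀,…,z_k) = z₀ ∘₀ (z₁ ∘₁ (⋯ z_k))`
(`…SahiE3LroSlot.cert_lro`) instead of the trivial base, with the blocks `{x // c x = i} → Bool` of a clause map `c : σ → Fin m`:
the first slot `⋁ᵢ ⋀_{c x = i} x ∨ F(z)` on the cube `σ ⊕ Fin (k+1) → Bool` carries a flow certificate for every product weight
(`cert_dnf_over_lro_cube`), hence `latticeE3 ≥ 0` over join-primes with a product pattern marginal (`latticeE3_nonneg_of_dnf_over_lro`)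
and for product weights on `2^κ` (`latticeE3_nonneg_dnf_over_lro_prod`).  Generalises `…SahiE3DnfWidthTwoOverLro` (all clauses of width
two).  HOME prim-l12-p4/FROM-prim-l12-p4-gen15-BLOCK-OR-STEP.md.
-/

namespace Summit.CriticalPhenomena.PercolationContinuityZ3.Theorems.SahiE3DnfOverLro

open Finset SahiE3BlocksOver SahiE3Dnf SahiE3LroTransport
open scoped BigOperators

/-- **The certificate of `⋁ᵢ ⋀_{c x = i} x ∨ F(z)` on the pattern cube** `σ ⊕ Fin (k+1) → Bool` (`F` the linear read-once formula with
operations `ops`), product weight `∏ w ≥ 0`. [this work] -/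
theorem cert_dnf_over_lro_cube {σ : Type*} [Fintype σ] [DecidableEq σ] (m : ℕ) (c : σ → Fin m) (k : ℕ) (ops : Fin k → Bool)
    (w : σ ⊕ Fin (k + 1) → Bool → ℝ) (hw : ∀ p b, 0 ≤ w p b) (ν : (σ ⊕ Fin (k + 1) → Bool) → ℝ) (hν : ∀ t, ν t = ∏ p, w p (t p))
    (U : Finset (σ ⊕ Fin (k + 1) → Bool))
    (hU : ∀ t, t ∈ U ↔ ((∃ i, ∀ x, c x = i → t (Sum.inl x) = true) ∨
      Fin.foldr k (fun i b => bif ops i then (t (Sum.inr i.castSucc) || b) else (t (Sum.inr i.castSucc) && b))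
        (t (Sum.inr (Fin.last k))) = true)) :
    IsUpperSet (U : Set (σ ⊕ Fin (k + 1) → Bool)) ∧
    ∃ (R : (σ ⊕ Fin (k + 1) → Bool) → ℝ) (Fl : (σ ⊕ Fin (k + 1) → Bool) → (σ ⊕ Fin (k + 1) → Bool) → ℝ),
      (∀ t ∈ U, 0 ≤ R t) ∧ (∀ t s, 0 ≤ Fl t s) ∧ (∀ t s, Fl t s ≠ 0 → s ≤ t) ∧
      (∀ t ∈ U, R t + ∑ s ∈ Uᶜ, Fl t s ≤ (∑ r, ν r) * ((∑ r, ν r) + ∑ r ∈ Uᶜ, ν r) * ν t) ∧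
      (∀ s ∈ Uᶜ, ∑ t ∈ U, Fl t s = (∑ r, ν r) * (∑ r ∈ U, ν r) * ν s) ∧
      (∀ S S' : Finset (σ ⊕ Fin (k + 1) → Bool), IsUpperSet (S : Set (σ ⊕ Fin (k + 1) → Bool)) →
        IsUpperSet (S' : Set (σ ⊕ Fin (k + 1) → Bool)) →
        (∑ r, ν r) * ((∑ t ∈ S, ν t) * (∑ t ∈ S' ∩ U, ν t) + (∑ t ∈ S', ν t) * (∑ t ∈ S ∩ U, ν t))
            - (∑ r ∈ U, ν r) * (∑ t ∈ S, ν t) * (∑ t ∈ S', ν t) ≤ ∑ t ∈ (S ∩ S') ∩ U, R t) := by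
  -- the base: the linear read-once formula on `Fin (k+1) → Bool`
  obtain ⟨νQ, hνQ⟩ : ∃ f : (Fin (k + 1) → Bool) → ℝ, ∀ q, f q = ∏ l, w (Sum.inr l) (q l) := ⟨_, fun _ => rfl⟩
  obtain ⟨G, hG⟩ : ∃ V : Finset (Fin (k + 1) → Bool), ∀ q, q ∈ V ↔ Fin.foldr k (fun i b => bif ops i then
      (q i.castSucc || b) else (q i.castSucc && b)) (q (Fin.last k)) = true :=
    ⟨univ.filter fun q => Fin.foldr k (fun i b => bif ops i then (q i.castSucc || b) else (q i.castSucc && b))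
      (q (Fin.last k)) = true, fun q => by simp⟩
  obtain ⟨hGup, hHQ, RQ, FlQ, g1, g2, g3, g4, g5, g6⟩ :=
    SahiE3LroSlot.cert_lro k ops (fun l => w (Sum.inr l)) (fun l b => hw _ _) νQ hνQ G hG
  have hνQ0 : ∀ q, 0 ≤ νQ q := fun q => by rw [hνQ]; exact Finset.prod_nonneg fun l _ => hw _ _
  obtain ⟨hUp, -, R, Fl, c1, c2, c3, c4, c5, c6⟩ := cert_blocks_over hνQ0 hHQ G hGup RQ FlQ g1 g2 g3 g4 g5 g6
    m (fun i => {x : σ // c x = i} → Bool) (fun i => fun _ => true) (fun i b xs => Bool.le_true _)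
    (fun i f => ∏ xs : {x : σ // c x = i}, w (Sum.inl xs.1) (f xs))
    (fun i f => Finset.prod_nonneg fun xs _ => hw _ _)
    (fun i => harris_boolPow (fun xs : {x : σ // c x = i} => w (Sum.inl xs.1)) (fun xs b => hw _ _) _ (fun _ => rfl))
    (fun y => (∏ i, ∏ xs : {x : σ // c x = i}, w (Sum.inl xs.1) (y.1 i xs)) * νQ y.2) (fun _ => rfl)
    (univ.filter fun y : (∀ i : Fin m, {x : σ // c x = i} → Bool) × (Fin (k + 1) → Bool) =>
      (∃ i, y.1 i = fun _ => true) ∨ y.2 ∈ G) (fun y => by simp)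
  -- transport to the cube `σ ⊕ Fin (k+1) → Bool`
  let e : ((∀ i : Fin m, {x : σ // c x = i} → Bool) × (Fin (k + 1) → Bool)) ≃o (σ ⊕ Fin (k + 1) → Bool) :=
    { toFun := fun y => Sum.elim (fun x => y.1 (c x) ⟨x, rfl⟩) y.2
      invFun := fun t => (fun i xs => t (Sum.inl xs.1), fun l => t (Sum.inr l))
      left_inv := fun y => by
        rcases y with ⟨f, q⟩
        apply Prod.ext
        · funext i xs
          obtain ⟨x, rfl⟩ := xs
          rfl
        · rfl
      right_inv := fun t => by
        funext p; rcases p with x | l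
        · rfl
        · rfl
      map_rel_iff' := by
        rintro ⟨f, q⟩ ⟨g, q'⟩
        simp only [Equiv.coe_fn_mk, Prod.mk_le_mk, Pi.le_def, Sum.forall, Sum.elim_inl, Sum.elim_inr]
        constructor
        · rintro ⟨h1, h2⟩
          refine ⟨fun i xs => ?_, h2⟩
          obtain ⟨x, rfl⟩ := xs
          exact h1 x
        · rintro ⟨h1, h2⟩
          exact ⟨fun x => h1 (c x) ⟨x, rfl⟩, h2⟩ }
  have hes : ∀ t : σ ⊕ Fin (k + 1) → Bool, e.symm t = (fun i xs => t (Sum.inl xs.1), fun l => t (Sum.inr l)) := fun t => rfl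
  have hνe : ∀ t, ν t = (fun y : (∀ i : Fin m, {x : σ // c x = i} → Bool) × (Fin (k + 1) → Bool) =>
      (∏ i, ∏ xs : {x : σ // c x = i}, w (Sum.inl xs.1) (y.1 i xs)) * νQ y.2) (e.symm t) := by
    intro t
    rw [hes]
    dsimp only
    rw [hν, Fintype.prod_sum_type, hνQ]
    congr 1
    rw [← Fintype.prod_sigma (fun p : Σ i : Fin m, {x : σ // c x = i} => w (Sum.inl p.2.1) (t (Sum.inl p.2.1)))]
    exact (Fintype.prod_equiv (Equiv.sigmaFiberEquiv c) _ _ fun p => rfl).symm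
  have hUe : ∀ t, t ∈ U ↔ e.symm t ∈ (univ.filter fun y : (∀ i : Fin m, {x : σ // c x = i} → Bool) × (Fin (k + 1) → Bool) =>
      (∃ i, y.1 i = fun _ => true) ∨ y.2 ∈ G) := by
    intro t
    rw [hes, hU, Finset.mem_filter]
    simp only [Finset.mem_univ, true_and, hG]
    refine or_congr (exists_congr fun i => ?_) Iff.rfl
    constructor
    · intro h; funext xs; exact h xs.1 xs.2
    · intro h x hx; exact congrFun h ⟨x, hx⟩
  obtain ⟨R', Fl', d1, d2, d3, d4, d5, d6⟩ := cert_transport e c1 c2 c3 c4 c5 c6 ν hνe U hUe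
  refine ⟨?_, R', Fl', d1, d2, d3, d4, d5, d6⟩
  intro x y hxy hx
  simp only [Finset.mem_coe] at hx ⊢
  rw [hUe] at hx ⊢
  exact hUp (e.symm.monotone hxy) hx

/-! ### The lattice theorem and the Boolean form -/

section Lattice

open Literature.Probability.LatticeModels

variable {α : Type*} [DistribLattice α] [Fintype α] [DecidableEq α] [DecidableLE α]

open scoped Classical in
/-- **Sahi's `C₃` for `⋁ᵢ ⋀_{c x = i} x ∨ F(z)` over join-primes, lattice form** (`F` linear read-once with operations `ops`;
product pattern marginal `∏ w`, `w ≥ 0`). [this work] -/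
theorem latticeE3_nonneg_of_dnf_over_lro {μ : α → ℝ} (hμ₀ : 0 ≤ μ)
    (hμ : ∀ x y, μ x * μ y ≤ μ (x ⊓ y) * μ (x ⊔ y)) {σ : Type*} [Fintype σ] [DecidableEq σ] (m : ℕ) (c : σ → Fin m)
    (k : ℕ) (ops : Fin k → Bool) {j : σ ⊕ Fin (k + 1) → α} (hj : ∀ i, SupPrime (j i))
    {F : (σ ⊕ Fin (k + 1) → Bool) → Finset α}
    (hF : ∀ (t : σ ⊕ Fin (k + 1) → Bool) (x : α), x ∈ F t ↔ ∀ i, (j i ≤ x ↔ t i = true))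
    {A B : Finset α} (hA : IsUpperSet (A : Set α)) (hB : IsUpperSet (B : Set α))
    (w : σ ⊕ Fin (k + 1) → Bool → ℝ) (hw : ∀ p b, 0 ≤ w p b) (hν : ∀ t, mass μ (F t) = ∏ p, w p (t p))
    (U' : Finset (σ ⊕ Fin (k + 1) → Bool))
    (hU' : ∀ t, t ∈ U' ↔ ((∃ i, ∀ x, c x = i → t (Sum.inl x) = true) ∨
      Fin.foldr k (fun i b => bif ops i then (t (Sum.inr i.castSucc) || b) else (t (Sum.inr i.castSucc) && b))
        (t (Sum.inr (Fin.last k))) = true)) :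
    0 ≤ latticeE3 μ (univ.filter fun x => (fun i => decide (j i ≤ x)) ∈ U') A B := by
  obtain ⟨-, R, Fl, h1, h2, h3, h4, h5, h6⟩ :=
    cert_dnf_over_lro_cube m c k ops w hw (fun t => ∏ p, w p (t p)) (fun _ => rfl) U' hU'
  refine SahiE3PatternCertificate.latticeE3_nonneg_of_patternCertificate hμ₀ hμ hj hF hA hB U'
    (fun t => ∏ p, w p (t p)) (fun t => (hν t).symm) R Fl h1 h2 h3 h4 (fun s hs => (h5 s hs).ge) ?_
  intro S S' hS hS'
  have hz : ∑ s ∈ (S ∩ S') ∩ U'ᶜ, (∑ t ∈ U', Fl t s - (∑ r : σ ⊕ Fin (k + 1) → Bool, ∏ p, w p (r p)) *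
      (∑ r ∈ U', ∏ p, w p (r p)) * ∏ p, w p (s p)) = 0 :=
    Finset.sum_eq_zero fun s hs => by rw [h5 s (Finset.mem_inter.1 hs).2, sub_self]
  rw [hz, add_zero]
  exact h6 S S' hS hS'

end Lattice

section Cube

open Literature.Probability.LatticeModels

variable {κ : Type*} [Fintype κ] [DecidableEq κ]

/-- **Kahn's Conjecture 5 for the first slot `⋁ᵢ ⋀_{c x = i} x ∨ F(z)`, product weights on `2^κ`** (`θ ≥ 0`, distinct generators
`v : σ ⊕ Fin (k+1) → κ`, clauses `c : σ → Fin m`, `F` linear read-once with operations `ops`, `A, B` arbitrary up-sets). [this work] -/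
theorem latticeE3_nonneg_dnf_over_lro_prod {θ : κ → ℝ} (hθ : ∀ u, 0 ≤ θ u) {σ : Type*} [Fintype σ] [DecidableEq σ] (m : ℕ)
    (c : σ → Fin m) (k : ℕ) (ops : Fin k → Bool)
    {v : σ ⊕ Fin (k + 1) → κ} (hv : Function.Injective v) {A B : Finset (Finset κ)}
    (hA : IsUpperSet (A : Set (Finset κ))) (hB : IsUpperSet (B : Set (Finset κ))) :
    0 ≤ latticeE3 (fun ω : Finset κ => ∏ u ∈ ω, θ u)
      (univ.filter fun ω : Finset κ => (∃ i, ∀ x, c x = i → v (Sum.inl x) ∈ ω) ∨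
        Fin.foldr k (fun i b => bif ops i then (decide (v (Sum.inr i.castSucc) ∈ ω) || b)
          else (decide (v (Sum.inr i.castSucc) ∈ ω) && b)) (decide (v (Sum.inr (Fin.last k)) ∈ ω)) = true) A B := by
  classical
  set F : (σ ⊕ Fin (k + 1) → Bool) → Finset (Finset κ) :=
    fun t => univ.filter fun ω : Finset κ => ∀ l, (v l ∈ ω ↔ t l = true) with hFdef
  have hF : ∀ (t : σ ⊕ Fin (k + 1) → Bool) (ω : Finset κ), ω ∈ F t ↔ ∀ l, (v l ∈ ω ↔ t l = true) := by
    intro t ω; simp [hFdef]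
  have hF' : ∀ (t : σ ⊕ Fin (k + 1) → Bool) (ω : Finset κ), ω ∈ F t ↔ ∀ l, (({v l} : Finset κ) ≤ ω ↔ t l = true) := by
    intro t ω; rw [hF]; simp
  set C : ℝ := ∑ ω ∈ ((univ : Finset (σ ⊕ Fin (k + 1))).image v)ᶜ.powerset, ∏ u ∈ ω, θ u with hC
  have hC0 : 0 ≤ C := Finset.sum_nonneg fun ω _ => Finset.prod_nonneg fun u _ => hθ u
  set w : σ ⊕ Fin (k + 1) → Bool → ℝ :=
    fun p b => (if b = true then θ (v p) else 1) * (if p = Sum.inr (Fin.last k) then C else 1) with hw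
  have hw0 : ∀ p b, 0 ≤ w p b := by
    intro p b; simp only [hw]
    refine mul_nonneg ?_ ?_ <;> split_ifs
    · exact hθ _
    · exact zero_le_one
    · exact hC0
    · exact zero_le_one
  have hν : ∀ t, mass (fun ω : Finset κ => ∏ u ∈ ω, θ u) (F t) = ∏ p, w p (t p) := by
    intro t
    rw [SahiE3LroCube.mass_fib_prod θ hv hF t, ← hC, hw, Finset.prod_mul_distrib,
      Finset.prod_ite_eq' univ (Sum.inr (Fin.last k) : σ ⊕ Fin (k + 1))]
    simp
  obtain ⟨U', hU'⟩ : ∃ V : Finset (σ ⊕ Fin (k + 1) → Bool), ∀ t, t ∈ V ↔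
      ((∃ i, ∀ x, c x = i → t (Sum.inl x) = true) ∨
      Fin.foldr k (fun i b => bif ops i then (t (Sum.inr i.castSucc) || b) else (t (Sum.inr i.castSucc) && b))
        (t (Sum.inr (Fin.last k))) = true) :=
    ⟨univ.filter fun t => (∃ i, ∀ x, c x = i → t (Sum.inl x) = true) ∨
      Fin.foldr k (fun i b => bif ops i then (t (Sum.inr i.castSucc) || b) else (t (Sum.inr i.castSucc) && b))
        (t (Sum.inr (Fin.last k))) = true, fun t => by simp⟩
  have key := latticeE3_nonneg_of_dnf_over_lro (SahiE3HitSlotProduct.prod_nonneg' hθ) (SahiE3HitSlotProduct.prod_lsm θ) m c k ops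
    (fun i => SahiE3CovHit.supPrime_singleton' (v i)) hF' hA hB w hw0 hν U' hU'
  have hslot : (univ.filter fun ω : Finset κ => (fun i => decide (({v i} : Finset κ) ≤ ω)) ∈ U') =
      univ.filter fun ω : Finset κ => (∃ i, ∀ x, c x = i → v (Sum.inl x) ∈ ω) ∨
        Fin.foldr k (fun i b => bif ops i then (decide (v (Sum.inr i.castSucc) ∈ ω) || b)
          else (decide (v (Sum.inr i.castSucc) ∈ ω) && b)) (decide (v (Sum.inr (Fin.last k)) ∈ ω)) = true := by
    congr 1; ext ω; simp [hU']
  rw [hslot] at key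
  exact key

end Cube

end Summit.CriticalPhenomena.PercolationContinuityZ3.Theorems.SahiE3DnfOverLro
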